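import Mathlib

/-!
# Tier7/Line3/CompactUnimodular — a Haar probability measure on a compact group is right- and inversion-invariant
(seat t7-L1-p2, gen 3)

LINE 3 (t7-plan-3), version (ii), memo v13 §2g: the line's archimedean test functions are matrix coefficients on the
compact group `U(W_A)(F_{ι₁})` (and its tori), integrated against the Haar PROBABILITY measure. The adjoint formula
`⟪R(f) x, y⟫ = ⟪x, R(f*) y⟫` of p1's row 692 (`T7SupportIntegratedForm.inner_integratedForm_eq`) and the
self-adjointness of `R(f)` for `f* = f` are stated there under the displayed hypothesis `[μ.IsInvInvariant]`
(inversion invariance of `μ`, i.e. unimodularity). THIS FILE discharges that hypothesis for every compact group: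
a Haar probability measure on a compact group is right-invariant (`isMulRightInvariant_of_compactSpace`) and
inversion-invariant (`isInvInvariant_of_compactSpace`). Mathlib has the inversion invariance only for commutative
groups (`IsHaarMeasure.isInvInvariant_of_regular`); the argument here is the uniqueness of Haar measure on compact
groups (`isMulInvariant_eq_smul_of_compactSpace`): `map (· * g) μ` and `μ.inv` are left-invariant finite measures,
hence scalar multiples of `μ`, and the scalar is `1` because both have total mass `1`.

Nothing here is about any specific group, any automorphic form, or any period; Mathlib only; no sorry;
axioms ⊆ {propext, Classical.choice, Quot.sound}.
-/

namespace Summit.Ventures.HodgeRepro2.Tier7.Line3.CompactUnimodular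

open MeasureTheory Measure
open scoped NNReal ENNReal

variable {G : Type*} [Group G] [TopologicalSpace G] [IsTopologicalGroup G] [CompactSpace G]
  [MeasurableSpace G] [BorelSpace G]

/-- **uniqueness of the Haar probability measure on a compact group**: a left-invariant finite measure `μ'` of
total mass `1` equals the Haar probability measure `μ`. -/
theorem eq_of_isMulLeftInvariant_of_measure_univ (μ μ' : Measure G) [IsHaarMeasure μ] [IsProbabilityMeasure μ]
    [IsMulLeftInvariant μ'] [IsFiniteMeasure μ'] (h : μ' Set.univ = 1) : μ' = μ := by
  have hμ' : μ' = haarScalarFactor μ' μ • μ := isMulInvariant_eq_smul_of_compactSpace μ' μ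
  have h1 : μ' Set.univ = ((haarScalarFactor μ' μ : ℝ≥0) : ℝ≥0∞) * μ Set.univ := by
    conv_lhs => rw [hμ']
    rw [Measure.smul_apply, ENNReal.smul_def, smul_eq_mul]
  rw [h, measure_univ, mul_one] at h1
  ext s _hs
  rw [hμ', Measure.smul_apply, ENNReal.smul_def, smul_eq_mul, ← h1, one_mul]

omit [CompactSpace G] in
/-- the right translate `map (· * g) μ` of a left-invariant measure is left-invariant. -/
theorem isMulLeftInvariant_map_mul_right (μ : Measure G) [IsMulLeftInvariant μ] (g : G) :
    IsMulLeftInvariant (map (· * g) μ) := by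
  constructor
  intro h
  rw [map_map (measurable_const_mul h) (measurable_mul_const g)]
  have e : ((h * ·) ∘ (· * g) : G → G) = (· * g) ∘ (h * ·) := by
    funext x
    simp only [Function.comp_apply, mul_assoc]
  rw [e, ← map_map (measurable_mul_const g) (measurable_const_mul h), map_mul_left_eq_self]

/-- **right invariance**: `map (· * g) μ = μ` for the Haar probability measure of a compact group. -/
theorem map_mul_right_eq_self_of_compactSpace (μ : Measure G) [IsHaarMeasure μ] [IsProbabilityMeasure μ] (g : G) :
    map (· * g) μ = μ := by
  haveI := isMulLeftInvariant_map_mul_right μ g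
  haveI : IsFiniteMeasure (map (· * g) μ) := isFiniteMeasure_map μ _
  refine eq_of_isMulLeftInvariant_of_measure_univ μ _ ?_
  rw [map_apply (measurable_mul_const g) MeasurableSet.univ, Set.preimage_univ, measure_univ]

/-- **a compact group is unimodular**: the Haar probability measure is right-invariant. -/
theorem isMulRightInvariant_of_compactSpace (μ : Measure G) [IsHaarMeasure μ] [IsProbabilityMeasure μ] :
    IsMulRightInvariant μ :=
  ⟨fun g => map_mul_right_eq_self_of_compactSpace μ g⟩

/-- **inversion invariance**: `μ.inv = μ` for the Haar probability measure of a compact group. -/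
theorem inv_eq_self_of_compactSpace (μ : Measure G) [IsHaarMeasure μ] [IsProbabilityMeasure μ] : μ.inv = μ := by
  haveI := isMulRightInvariant_of_compactSpace μ
  haveI : IsFiniteMeasure μ.inv := by
    unfold Measure.inv
    exact isFiniteMeasure_map μ _
  refine eq_of_isMulLeftInvariant_of_measure_univ μ _ ?_
  rw [inv_apply, Set.inv_univ, measure_univ]

/-- **inversion invariance as the Mathlib class**: the displayed hypothesis `[μ.IsInvInvariant]` of row 692's
adjoint formula holds for the Haar probability measure of every compact group. -/
theorem isInvInvariant_of_compactSpace (μ : Measure G) [IsHaarMeasure μ] [IsProbabilityMeasure μ] :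
    IsInvInvariant μ :=
  ⟨inv_eq_self_of_compactSpace μ⟩

/-- the substitution `g ↦ g⁻¹` in an integral against the Haar probability measure of a compact group. -/
theorem integral_inv_eq_self_of_compactSpace {E : Type*} [NormedAddCommGroup E] [NormedSpace ℝ E]
    (μ : Measure G) [IsHaarMeasure μ] [IsProbabilityMeasure μ] (f : G → E) :
    ∫ g, f g⁻¹ ∂μ = ∫ g, f g ∂μ := by
  haveI := isInvInvariant_of_compactSpace μ
  exact integral_inv_eq_self f μ

/-- the substitution `g ↦ g * h` in an integral against the Haar probability measure of a compact group. -/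
theorem integral_mul_right_eq_self_of_compactSpace {E : Type*} [NormedAddCommGroup E] [NormedSpace ℝ E]
    (μ : Measure G) [IsHaarMeasure μ] [IsProbabilityMeasure μ] (f : G → E) (h : G) :
    ∫ g, f (g * h) ∂μ = ∫ g, f g ∂μ := by
  haveI := isMulRightInvariant_of_compactSpace μ
  exact integral_mul_right_eq_self f h

end Summit.Ventures.HodgeRepro2.Tier7.Line3.CompactUnimodular
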